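import Mathlib

/-!
# Tier4/Common/DefiniteBound — the isometries of a DEFINITE real form have bounded entries: `M B Mᵀ = B` with `B`
positive (or negative) definite forces `|M i j| ≤ C` for a constant `C` depending on `B` only

Blind re-derivation cell `pub-hodge-repro`, Tier 4 «prove the step» (README §9–§10), seat t4-typer-2 (gen 3).
Target tree path `lean/Summits/Ventures/HodgeRepro/Tier4/Common/DefiniteBound.lean`.  Mathlib only; no literature.

WHY.  The archimedean compactness of `U(W)` on a totally definite plane (LINE L1's displayed `hcomp : IsCompact
(infinitePart W)`, F-L1-ARCH S13818 / S13885; the compactness of the local tori behind the `(C, χ)`-projector) is, at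
each real place, the statement that the real isometry group `{M | M B_w Mᵀ = B_w}` of the definite form `B_w` is
closed AND bounded.  Boundedness is this module: a positive definite `B` is bounded below by `m ‖x‖²` on `x ⬝ᵥ (B x)`
(the minimum `m > 0` of the quadratic form on the compact unit sphere), and the `i`-th row `r` of an isometry `M`
satisfies `r ⬝ᵥ (B r) = (M B Mᵀ) i i = B i i`, so `m ‖r‖² ≤ B i i ≤ tr B`.

* `quadForm B x := x ⬝ᵥ (B *ᵥ x)`, `continuous_quadForm`, `quadForm_smul`;
* **`exists_pos_le_quadForm`** — `B.PosDef` ⇒ `∃ m > 0, ∀ x, m * ‖x‖ ^ 2 ≤ quadForm B x` (sup norm on `n → ℝ`);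
* `diag_mul_mul_transpose` — `(M * B * Mᵀ) i i = quadForm B (M i)`;
* **`exists_bound_of_posDef`** — `B.PosDef` ⇒ `∃ C ≥ 0, ∀ M, M * B * Mᵀ = B → ∀ i j, |M i j| ≤ C`;
* **`exists_bound_of_definite`** — the same for `B.PosDef ∨ (-B).PosDef`.

Nothing here says anything about the status of the Hodge conjecture for CM abelian varieties, which is NOT proved
(HC_CM is NOT proved by anyone in this repository).
-/

set_option autoImplicit false

noncomputable section

namespace Summit.Ventures.HodgeRepro.Tier4.Common

open Matrix Set

section Quad

variable {n : Type} [Fintype n]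

/-- The quadratic form `x ↦ x ⬝ᵥ (B x)` of a real matrix. -/
def quadForm (B : Matrix n n ℝ) (x : n → ℝ) : ℝ := x ⬝ᵥ (B *ᵥ x)

/-- The quadratic form is continuous. -/
theorem continuous_quadForm (B : Matrix n n ℝ) : Continuous (quadForm B) :=
  continuous_id.dotProduct (continuous_const.matrix_mulVec continuous_id)

/-- The quadratic form is homogeneous of degree `2`. -/
theorem quadForm_smul (B : Matrix n n ℝ) (c : ℝ) (x : n → ℝ) : quadForm B (c • x) = c ^ 2 * quadForm B x := by
  simp only [quadForm, Matrix.mulVec_smul, smul_dotProduct, dotProduct_smul, smul_eq_mul]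
  ring

/-- A positive definite form is positive off `0`. -/
theorem quadForm_pos_of_posDef {B : Matrix n n ℝ} (hB : B.PosDef) {x : n → ℝ} (hx : x ≠ 0) : 0 < quadForm B x := by
  have := hB.dotProduct_mulVec_pos hx
  simpa [quadForm] using this

/-- **A positive definite form is bounded below by a multiple of the squared norm**: the minimum of the form on the
compact unit sphere is positive. -/
theorem exists_pos_le_quadForm [Nonempty n] {B : Matrix n n ℝ} (hB : B.PosDef) :
    ∃ m : ℝ, 0 < m ∧ ∀ x : n → ℝ, m * ‖x‖ ^ 2 ≤ quadForm B x := by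
  have hS : IsCompact (Metric.sphere (0 : n → ℝ) 1) := isCompact_sphere 0 1
  have hSne : (Metric.sphere (0 : n → ℝ) 1).Nonempty := NormedSpace.sphere_nonempty.2 zero_le_one
  obtain ⟨x₀, hx₀S, hmin⟩ := hS.exists_isMinOn hSne (continuous_quadForm B).continuousOn
  have hx₀ : x₀ ≠ 0 := by
    intro h
    rw [mem_sphere_zero_iff_norm] at hx₀S
    rw [h, norm_zero] at hx₀S
    exact zero_ne_one hx₀S
  refine ⟨quadForm B x₀, quadForm_pos_of_posDef hB hx₀, fun x => ?_⟩
  by_cases hx : x = 0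
  · subst hx
    simp [quadForm]
  · have hnorm : 0 < ‖x‖ := norm_pos_iff.2 hx
    set u : n → ℝ := ‖x‖⁻¹ • x with hu
    have huS : u ∈ Metric.sphere (0 : n → ℝ) 1 := by
      rw [mem_sphere_zero_iff_norm, hu, norm_smul, norm_inv, norm_norm, inv_mul_cancel₀ hnorm.ne']
    have hxu : x = ‖x‖ • u := by
      rw [hu, smul_smul, mul_inv_cancel₀ hnorm.ne', one_smul]
    have hmin' : quadForm B x₀ ≤ quadForm B u := hmin huS
    have hq : quadForm B x = ‖x‖ ^ 2 * quadForm B u := by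
      conv_lhs => rw [hxu]
      rw [quadForm_smul]
    calc quadForm B x₀ * ‖x‖ ^ 2 ≤ quadForm B u * ‖x‖ ^ 2 := by
          apply mul_le_mul_of_nonneg_right hmin' (sq_nonneg _)
      _ = quadForm B x := by rw [hq]; ring

/-- The `i`-th diagonal entry of `M B Mᵀ` is the form evaluated on the `i`-th row of `M`. -/
theorem diag_mul_mul_transpose (B M : Matrix n n ℝ) (i : n) : (M * B * Mᵀ) i i = quadForm B (M i) := by
  simp only [quadForm, Matrix.mul_apply', Matrix.mulVec, dotProduct, Matrix.transpose_apply]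
  simp only [Finset.sum_mul, Finset.mul_sum]
  rw [Finset.sum_comm]
  refine Finset.sum_congr rfl fun x _ => Finset.sum_congr rfl fun y _ => by ring

/-- **Isometries of a positive definite form have bounded entries.** -/
theorem exists_bound_of_posDef [Nonempty n] {B : Matrix n n ℝ} (hB : B.PosDef) :
    ∃ C : ℝ, 0 ≤ C ∧ ∀ M : Matrix n n ℝ, M * B * Mᵀ = B → ∀ i j, |M i j| ≤ C := by
  obtain ⟨m, hm, hle⟩ := exists_pos_le_quadForm hB
  set T : ℝ := ∑ i, B i i with hT
  have hT0 : 0 ≤ T := Finset.sum_nonneg fun i _ => (hB.diag_pos).le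
  refine ⟨Real.sqrt (T / m), Real.sqrt_nonneg _, fun M hM i j => ?_⟩
  have hrow : quadForm B (M i) = B i i := by
    rw [← diag_mul_mul_transpose, hM]
  have h1 : m * ‖M i‖ ^ 2 ≤ B i i := hrow ▸ hle (M i)
  have h2 : B i i ≤ T := by
    rw [hT]
    exact Finset.single_le_sum (fun k _ => (hB.diag_pos (i := k)).le) (Finset.mem_univ i)
  have h3 : ‖M i‖ ^ 2 ≤ T / m := by
    rw [le_div_iff₀ hm, mul_comm]
    exact h1.trans h2
  have h4 : ‖M i‖ ≤ Real.sqrt (T / m) := by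
    rw [← Real.sqrt_sq (norm_nonneg (M i))]
    exact Real.sqrt_le_sqrt h3
  calc |M i j| = ‖M i j‖ := (Real.norm_eq_abs _).symm
    _ ≤ ‖M i‖ := norm_le_pi_norm (M i) j
    _ ≤ Real.sqrt (T / m) := h4

/-- **Isometries of a definite form (positive or negative) have bounded entries.** -/
theorem exists_bound_of_definite [Nonempty n] {B : Matrix n n ℝ} (hB : B.PosDef ∨ (-B).PosDef) :
    ∃ C : ℝ, 0 ≤ C ∧ ∀ M : Matrix n n ℝ, M * B * Mᵀ = B → ∀ i j, |M i j| ≤ C := by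
  rcases hB with hB | hB
  · exact exists_bound_of_posDef hB
  · obtain ⟨C, hC0, hC⟩ := exists_bound_of_posDef hB
    refine ⟨C, hC0, fun M hM i j => hC M ?_ i j⟩
    rw [Matrix.mul_neg, Matrix.neg_mul, hM]

end Quad

end Summit.Ventures.HodgeRepro.Tier4.Common

end
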